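import Summits.KontsevichZagierPeriods.KontsevichZagierPeriods.Theorems.OctahedralSymmetryOctahedralSpanAllWeightsStubRegularE0DepthTwo
import Summits.KontsevichZagierPeriods.KontsevichZagierPeriods.Theorems.OctahedralSymmetryOctahedralSpanAllWeightsLowWeights
import HarnessLib

/-!
# Block F1 of the crux `OctahedralSpanAllWeights` (stmt-KontsevichZagierPeriods-9659), line `Sketch`: depth three over the poles `{0, i, -i}` — generators

Helper file 1/2 for the registered sub-layer stub `stub_regular_e0_depthThree_binary` (depth-three
`e₁`-free words with letters in `{1, 3, 4}`), namespace `…OctaSpan.RegularE0`.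
1. Generic facts on words of indices and on the level-4 stuffle `stuffleIdx k l`: letters `4`/`0` of
   `wordAux` (`count_four_wordAux`; the Boolean `e₁`-freeness check `e1ok` on exponents,
   `count_zero_wordAux`), the stuffle of exponent lists `expSt` (`map_snd_stuffleIdx`), weight
   additivity/depth bound of stuffle terms (`stuffle_wt`), and the **top extraction** `fds_top` /
   `top_mem`: in `fds(k, l) ∈ rel` the depth-`|k|` stuffle terms (all parts of `l` merged into `k`)
   sum to an element of `rel ⊔ (lower span)`, deeper terms and shuffles having fewer letters `4`.
2. The binary depth-three words `X3 a₁ a₂ a₃ b₁ b₂ b₃ = 4^{a₁} c₁ 4^{a₂} c₂ 4^{a₃} c₃` (`cⱼ = col bⱼ ∈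
   {1, 3}`, poles `±i`), their index `K3`, target module `T3 m` and classes `y3 m a₁ a₂ b₁ b₂ b₃`.
3. Three families of finite double shuffles of `K3` whose top terms stay binary (merging a part of
   exponent `2`, pole `-1`, swaps the colours `i ↔ -i` from that block on, written `!b`): `l = ((s,2))`
   (family B, `relB`), `l = ((s,2),(t,0))` (B2, `relB2`), `l = ((1,2),(1,0),(1,0))` (M33, `relM33`: its
   single triply merged term kills every word with three nonempty blocks of `4`).
4. For file 2/2: the lift principle with a lifting word containing `4` (`liftMap_mem_sup_e0Lower'`)
   and the layer `m = 1` from the landed weight-four normal form (`depthThree_one`).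

References: J. Zhao, Doc. Math. 15 (2010), §2 Def. 2.4 (stuffle), (FDS) [Zhao2010]; M. E. Hoffman,
J. Algebra 194 (1997), §2 (quasi-shuffle recursion) [Hoffman1997].
-/

noncomputable section

namespace Summit.KontsevichZagierPeriods.OctahedralSymmetry.OctaSpan.RegularE0

open Literature.NumberTheory.Transcendental Literature.NumberTheory.Transcendental.LevelFour

/-! ## Words of indices and stuffle terms -/

/-- The weight `s₁ + ⋯ + s_d` of an index. [folklore] -/
abbrev wt (k : List (ℕ × Fin 4)) : ℕ := (k.map Prod.fst).sum

/-- The word of an index with parts `≥ 1` has `weight − depth` letters `4`. [folklore] -/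
theorem count_four_wordAux : ∀ (acc : Fin 4) (k : List (ℕ × Fin 4)), (∀ p ∈ k, 1 ≤ p.1) →
    (wordAux acc k).count 4 + k.length = wt k
  | _, [], _ => rfl
  | acc, p :: k, h => by
    have hp : 1 ≤ p.1 := h p (by simp)
    have ih := count_four_wordAux (acc + p.2) k fun q hq => h q (by simp [hq])
    have h4 : ∀ x : Fin 4, Fin.castSucc x ≠ (4 : Fin 5) := by decide
    simp only [wt, List.map_cons, List.sum_cons] at ih ⊢
    simp only [wordAux, List.count_append, List.count_replicate_self, List.count_singleton',
      if_neg (h4 _), List.length_cons]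
    omega

/-- Boolean check on exponents `e₁, …, e_d` that all cumulative sums `acc + e₁ + ⋯ + eⱼ` (`j ≥ 1`)
are nonzero: the word of such an index, read from `acc`, has no letter `0` (pole `1`). [folklore] -/
def e1ok : Fin 4 → List (Fin 4) → Bool
  | _, [] => true
  | acc, e :: k => decide (acc + e ≠ 0) && e1ok (acc + e) k

/-- `e1ok` certifies `e₁`-freeness of the word. [folklore] -/
theorem count_zero_wordAux : ∀ (acc : Fin 4) (k : List (ℕ × Fin 4)),
    e1ok acc (k.map Prod.snd) = true → (wordAux acc k).count 0 = 0
  | _, [], _ => rfl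
  | acc, p :: k, h => by
    simp only [List.map_cons, e1ok, Bool.and_eq_true, decide_eq_true_eq] at h
    have hcs0 : ∀ x : Fin 4, x ≠ 0 → Fin.castSucc x ≠ (0 : Fin 5) := by decide
    simp only [wordAux, List.count_append, List.count_singleton',
      if_neg (hcs0 _ (neg_ne_zero.2 h.1)), count_zero_wordAux _ k h.2]
    simp [List.count_replicate]

/-- Inner recursion of the stuffle of exponent lists (mirror of `stuffleIdxAux`). [folklore] -/
def expStAux (e : Fin 4) (stK : List (Fin 4) → List (List (Fin 4))) (ek : List (Fin 4)) :
    List (Fin 4) → List (List (Fin 4))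
  | [] => [ek]
  | f :: l => (stK (f :: l)).map (List.cons e) ++
      ((expStAux e stK ek l).map (List.cons f) ++ (stK l).map (List.cons (e + f)))

/-- The stuffle of exponent lists (mirror of `stuffleIdx` forgetting the parts `sⱼ`): all that
`e1ok` needs, as a closed computation. [folklore] -/
def expSt : List (Fin 4) → List (Fin 4) → List (List (Fin 4))
  | [], l => [l]
  | e :: k, l => expStAux e (expSt k) (e :: k) l

/-- **The exponents of the stuffle terms are the stuffle of the exponents.** [folklore] -/
theorem map_snd_stuffleIdx : ∀ (k l : List (ℕ × Fin 4)),
    (stuffleIdx k l).map (List.map Prod.snd) = expSt (k.map Prod.snd) (l.map Prod.snd)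
  | [], l => rfl
  | p :: k, [] => by rw [stuffleIdx_nil_right]; rfl
  | p :: k, q :: l => by
    have e1 := map_snd_stuffleIdx k (q :: l)
    have e2 := map_snd_stuffleIdx (p :: k) l
    have e3 := map_snd_stuffleIdx k l
    rw [List.map_cons] at e1 e2
    rw [stuffleIdx_cons_cons, List.map_append, List.map_append, List.map_cons, List.map_cons, expSt,
      expStAux, ← expSt, ← e1, ← e2, ← e3]
    simp only [List.map_map, Function.comp_def, List.map_cons]
  termination_by k l => k.length + l.length

/-- An `e₁`-free word of a nonempty index is convergent (its last letter is a pole `i^x`). [folklore] -/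
theorem isConvergent_word_of_count_zero {k : List (ℕ × Fin 4)} (hk : k ≠ [])
    (h0 : (word k).count 0 = 0) : IsConvergent (word k) := by
  refine ⟨fun h => (List.count_pos_iff.2 (List.mem_of_mem_head? h)).ne' h0, fun h => ?_⟩
  obtain ⟨x, hx⟩ := getLast?_wordAux 0 hk
  have h4 : ∀ x : Fin 4, Fin.castSucc x ≠ (4 : Fin 5) := by decide
  rw [word] at h
  exact h4 x (by rw [hx, Option.some.injEq] at h; exact h)

/-- **Stuffle terms: weight additivity, depth bound, positivity of parts.** [cite: Zhao2010, Def. 2.4] -/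
theorem stuffle_wt : ∀ (k l : List (ℕ × Fin 4)), ∀ j ∈ stuffleIdx k l,
    wt j = wt k + wt l ∧ k.length ≤ j.length ∧
      ((∀ p ∈ k, 1 ≤ p.1) → (∀ p ∈ l, 1 ≤ p.1) → ∀ p ∈ j, 1 ≤ p.1)
  | [], l, j, hj => by
    obtain rfl : j = l := by simpa using hj
    exact ⟨by simp [wt], by simp, fun _ hl => hl⟩
  | p :: k, [], j, hj => by
    obtain rfl : j = p :: k := by simpa using hj
    exact ⟨by simp [wt], le_rfl, fun hk _ => hk⟩
  | p :: k, q :: l, j, hj => by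
    rw [stuffleIdx_cons_cons, List.mem_append, List.mem_append, List.mem_map, List.mem_map,
      List.mem_map] at hj
    rcases hj with ⟨j, hj, rfl⟩ | ⟨j, hj, rfl⟩ | ⟨j, hj, rfl⟩
    · obtain ⟨h1, h2, h3⟩ := stuffle_wt k (q :: l) j hj
      refine ⟨?_, by simp only [List.length_cons]; omega, fun hk hl r hr => ?_⟩
      · simp only [wt, List.map_cons, List.sum_cons] at h1 ⊢; omega
      · rcases List.mem_cons.1 hr with rfl | hr
        · exact hk _ (by simp)
        · exact h3 (fun x hx => hk x (by simp [hx])) hl r hr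
    · obtain ⟨h1, h2, h3⟩ := stuffle_wt (p :: k) l j hj
      refine ⟨?_, by simp only [List.length_cons] at h2 ⊢; omega, fun hk hl r hr => ?_⟩
      · simp only [wt, List.map_cons, List.sum_cons] at h1 ⊢; omega
      · rcases List.mem_cons.1 hr with rfl | hr
        · exact hl _ (by simp)
        · exact h3 hk (fun x hx => hl x (by simp [hx])) r hr
    · obtain ⟨h1, h2, h3⟩ := stuffle_wt k l j hj
      refine ⟨?_, by simp only [List.length_cons]; omega, fun hk hl r hr => ?_⟩
      · simp only [wt, List.map_cons, List.sum_cons] at h1 ⊢; omega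
      · rcases List.mem_cons.1 hr with rfl | hr
        · have := hk p (by simp); dsimp only; omega
        · exact h3 (fun x hx => hk x (by simp [hx])) (fun x hx => hl x (by simp [hx])) r hr
  termination_by k l => k.length + l.length

/-- `toQ (ofTerms (L.map f)) = ∑_{x ∈ L} (f x).1 • [(f x).2]`. [folklore] -/
theorem toQ_ofTerms_map {β : Type*} (L : List β) (f : β → ℤ × List (Fin 5)) :
    toQ (ofTerms (L.map f)) = (L.map fun x => (f x).1 • sym (f x).2).sum := by
  induction L with
  | nil => simp
  | cons x L ih => rw [List.map_cons, ofTerms_cons, map_add, toQ_single, ih, List.map_cons,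
      List.sum_cons]

/-- Splitting a list sum along a Boolean predicate. [folklore] -/
theorem sum_map_filter_add {β M : Type*} [AddCommMonoid M] (L : List β) (p : β → Bool) (f : β → M) :
    ((L.filter p).map f).sum + ((L.filter fun x => !p x).map f).sum = (L.map f).sum := by
  induction L with
  | nil => simp
  | cons x L ih => cases hx : p x <;> simp [hx, ← ih, add_assoc, add_left_comm]

/-- **Top extraction from a finite double shuffle.** In `fds(k, l) = ∑_{j ∈ k ∗ l} ± [word j] −
word k ш word l ∈ rel` the depth-`|k|` stuffle terms (all of `l` merged into parts of `k`) carry the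
sign `(-1)^{|l|}`: if `T` contains the other terms, their plain sum is in `rel ⊔ T`. [cite: Zhao2010, §2] -/
theorem fds_top {k l : List (ℕ × Fin 4)} (hk : IsConvergentIdx k) (hl : IsConvergentIdx l)
    (T : Submodule ℚ WordQ) (hlow : ∀ j ∈ stuffleIdx k l, j.length ≠ k.length → sym (word j) ∈ T)
    (hsh : toQ (shuffle (word k) (word l)) ∈ T) :
    (((stuffleIdx k l).filter fun j => j.length = k.length).map fun j => sym (word j)).sum ∈ rel ⊔ T := by
  set p : List (ℕ × Fin 4) → Bool := fun j => decide (j.length = k.length) with hp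
  set F : List (ℕ × Fin 4) → WordQ := fun j =>
    ((-1 : ℤ) ^ (k.length + l.length + j.length)) • sym (word j) with hF
  have hst : toQ (stuffleSigned k l) = ((stuffleIdx k l).map F).sum := toQ_ofTerms_map _ _
  have hsplit := sum_map_filter_add (stuffleIdx k l) p F
  have htop : (((stuffleIdx k l).filter p).map F).sum =
      ((-1 : ℤ) ^ l.length) • (((stuffleIdx k l).filter p).map fun j => sym (word j)).sum := by
    rw [List.smul_sum, List.map_map]
    refine congrArg _ (List.map_congr_left fun j hj => ?_)
    have hjl : j.length = k.length := by simpa [hp] using (List.mem_filter.1 hj).2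
    simp only [Function.comp_apply, hF, hjl]
    rw [show k.length + l.length + k.length = l.length + 2 * k.length by ring, pow_add, pow_mul]
    simp
  have hlow' : (((stuffleIdx k l).filter fun x => !p x).map F).sum ∈ T := by
    refine T.list_sum_mem fun x hx => ?_
    obtain ⟨j, hj, rfl⟩ := List.mem_map.1 hx
    exact zsmul_mem (hlow j (List.mem_filter.1 hj).1 (by simpa [hp] using (List.mem_filter.1 hj).2)) _
  have key : (((stuffleIdx k l).filter p).map fun j => sym (word j)).sum =
      ((-1 : ℤ) ^ l.length) • (fdsGen k l + toQ (shuffle (word k) (word l)) -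
        (((stuffleIdx k l).filter fun x => !p x).map F).sum) := by
    rw [fdsGen, hst, ← hsplit, htop, sub_add_cancel, add_sub_cancel_right, smul_smul, ← pow_add,
      ← two_mul, pow_mul]
    simp
  rw [key]
  exact zsmul_mem (Submodule.sub_mem _ (Submodule.add_mem _
    (Submodule.mem_sup_left (mem_rel_of_isGen (IsGen.fds hk hl))) (Submodule.mem_sup_right hsh))
    (Submodule.mem_sup_right hlow')) _

/-! ## Binary depth-three words -/

/-- The letter of a colour bit: `true ↦ 1` (pole `i`), `false ↦ 3` (pole `-i`). [folklore] -/
def col (b : Bool) : Fin 5 := bif b then 1 else 3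

/-- The same letter as an exponent in `ℤ/4`. [folklore] -/
def lx (b : Bool) : Fin 4 := bif b then 1 else 3

/-- The binary depth-three word `4^{a₁} c₁ 4^{a₂} c₂ 4^{a₃} c₃`, `cⱼ = col bⱼ`. [folklore] -/
def X3 (a₁ a₂ a₃ : ℕ) (b₁ b₂ b₃ : Bool) : List (Fin 5) :=
  List.replicate a₁ 4 ++ col b₁ :: (List.replicate a₂ 4 ++ col b₂ :: (List.replicate a₃ 4 ++ [col b₃]))

/-- Its index `((a₁+1, ·), (a₂+1, ·), (a₃+1, ·))` (exponents with cumulative sums `-cⱼ`). [folklore] -/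
def K3 (a₁ a₂ a₃ : ℕ) (b₁ b₂ b₃ : Bool) : List (ℕ × Fin 4) :=
  [(a₁ + 1, -lx b₁), (a₂ + 1, lx b₁ - lx b₂), (a₃ + 1, lx b₂ - lx b₃)]

/-- Colour letters are not `4`. [folklore] -/
theorem col_ne_four (b : Bool) : col b ≠ 4 := by cases b <;> decide

/-- Colour letters are not `0`. [folklore] -/
theorem col_ne_zero (b : Bool) : col b ≠ 0 := by cases b <;> decide

/-- `|X3| = a₁ + a₂ + a₃ + 3`. [folklore] -/
theorem X3_length (a₁ a₂ a₃ : ℕ) (b₁ b₂ b₃ : Bool) : (X3 a₁ a₂ a₃ b₁ b₂ b₃).length = a₁ + a₂ + a₃ + 3 := by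
  simp [X3]; omega

/-- `X3` has `a₁ + a₂ + a₃` letters `4`. [folklore] -/
theorem X3_count_four (a₁ a₂ a₃ : ℕ) (b₁ b₂ b₃ : Bool) : (X3 a₁ a₂ a₃ b₁ b₂ b₃).count 4 = a₁ + a₂ + a₃ := by
  simp [X3, col_ne_four]; omega

/-- The lower span is the same for all words of the binary depth-three block. [folklore] -/
theorem e0Lower_X3 (a₁ a₂ a₃ : ℕ) (b₁ b₂ b₃ : Bool) :
    e0Lower (X3 a₁ a₂ a₃ b₁ b₂ b₃) = e0Lower (X3 0 0 (a₁ + a₂ + a₃) true true true) :=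
  e0Lower_eq (by rw [X3_length, X3_length]; omega) (by rw [X3_count_four, X3_count_four]; omega)

/-- The common target module of the block at layer `m` (`m` letters `4`). [folklore] -/
def T3 (m : ℕ) : Submodule ℚ WordQ := rel ⊔ e0Lower (X3 0 0 m true true true)

/-- The unknowns: classes of `[4^{a₁} c₁ 4^{a₂} c₂ 4^{m-a₁-a₂} c₃]` modulo `T3 m`. [folklore] -/
def y3 (m a₁ a₂ : ℕ) (b₁ b₂ b₃ : Bool) : WordQ ⧸ T3 m :=
  (T3 m).mkQ (sym (X3 a₁ a₂ (m - a₁ - a₂) b₁ b₂ b₃))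

/-- `y3` with an explicit third exponent. [folklore] -/
theorem y3_eq {m a₁ a₂ a₃ : ℕ} (h : a₁ + a₂ + a₃ = m) (b₁ b₂ b₃ : Bool) :
    y3 m a₁ a₂ b₁ b₂ b₃ = (T3 m).mkQ (sym (X3 a₁ a₂ a₃ b₁ b₂ b₃)) := by
  rw [y3, show m - a₁ - a₂ = a₃ by omega]

/-! ## The three binary families of finite double shuffles -/

/-- `K3` is a convergent index. [folklore] -/
theorem isConvergentIdx_K3 (a₁ a₂ a₃ : ℕ) (b₁ b₂ b₃ : Bool) :
    IsConvergentIdx (K3 a₁ a₂ a₃ b₁ b₂ b₃) :=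
  isConvergentIdx_cons (by omega) (fun _ => by cases b₁ <;> decide) (by simp)

/-- **Top terms of `fds(k, l)` modulo the lower span**: if all stuffle terms of `k ∗ l` are `e₁`-free
(a finite check on exponents) and `k`, `l ≠ []` are convergent and `e₁`-free, the depth-`|k|` terms
sum into `rel ⊔ e0Lower W` for `W` of length `wt k + wt l` with `wt k + wt l - |k|` fours. [folklore] -/
theorem top_mem {k l : List (ℕ × Fin 4)} {ke le : List (Fin 4)} (hk : IsConvergentIdx k)
    (hl : IsConvergentIdx l) (hlne : l ≠ []) (hke : k.map Prod.snd = ke) (hle : l.map Prod.snd = le)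
    (hk0 : e1ok 0 ke = true) (hl0 : e1ok 0 le = true) (hall : (expSt ke le).all (e1ok 0) = true)
    {W : List (Fin 5)} (hWl : W.length = wt k + wt l) (hW4 : W.count 4 + k.length = wt k + wt l) :
    (((stuffleIdx k l).filter fun j => j.length = k.length).map fun j => sym (word j)).sum ∈
      rel ⊔ e0Lower W := by
  subst hke hle
  have hkpos : ∀ p ∈ k, 1 ≤ p.1 := hk.1
  have hlpos : ∀ p ∈ l, 1 ≤ p.1 := hl.1
  have h4k : (word k).count 4 + k.length = wt k := count_four_wordAux 0 k hkpos
  have h4l : (word l).count 4 + l.length = wt l := count_four_wordAux 0 l hlpos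
  have hl1 : 1 ≤ l.length := List.length_pos_iff.2 hlne
  refine fds_top hk hl _ (fun j hj hjl => ?_) ?_
  · obtain ⟨hwt, hlen, hpos⟩ := stuffle_wt k l j hj
    have hpos := hpos hkpos hlpos
    have hje : j.map Prod.snd ∈ expSt (k.map Prod.snd) (l.map Prod.snd) :=
      map_snd_stuffleIdx k l ▸ List.mem_map_of_mem hj
    have h0 : (word j).count 0 = 0 := count_zero_wordAux 0 j (List.all_eq_true.1 hall _ hje)
    have h4 : (word j).count 4 + j.length = wt j := count_four_wordAux 0 j hpos
    refine sym_mem_e0Lower ?_ (isConvergent_word_of_count_zero ?_ h0) h0 ?_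
    · rw [length_word j hpos, hWl]; exact hwt
    · rintro rfl
      simp only [List.length_nil, Nat.le_zero, List.length_eq_zero_iff] at hlen
      exact hjl (by rw [hlen])
    · omega
  · refine toQ_shuffle_mem _ _ _ fun w hw => ?_
    have hperm := MZV.perm_of_mem_shuffleWord _ _ hw
    refine sym_mem_e0Lower ?_ ?_ ?_ ?_
    · rw [hperm.length_eq, List.length_append, length_word k hkpos, length_word l hlpos, hWl]
    · exact isConvergent_of_mem_shuffleWord (isConvergent_word hk) (isConvergent_word hl) hw
    · have h0k : (word k).count 0 = 0 := count_zero_wordAux 0 k hk0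
      have h0l : (word l).count 0 = 0 := count_zero_wordAux 0 l hl0
      rw [hperm.count_eq, List.count_append, h0k, h0l]
    · rw [hperm.count_eq, List.count_append]; omega

/-- The exponents of `K3`. [folklore] -/
theorem map_snd_K3 (a₁ a₂ a₃ : ℕ) (b₁ b₂ b₃ : Bool) :
    (K3 a₁ a₂ a₃ b₁ b₂ b₃).map Prod.snd = [-lx b₁, lx b₁ - lx b₂, lx b₂ - lx b₃] := rfl

/-- `e₁`-freeness checks (closed computations on exponents): `K3` and its stuffles with the
exponent lists `(2)`, `(2, 0)`, `(2, 0, 0)` of the three families. [folklore] -/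
theorem e1ok_families (b₁ b₂ b₃ : Bool) :
    e1ok 0 [-lx b₁, lx b₁ - lx b₂, lx b₂ - lx b₃] = true ∧
      (expSt [-lx b₁, lx b₁ - lx b₂, lx b₂ - lx b₃] [2]).all (e1ok 0) = true ∧
      (expSt [-lx b₁, lx b₁ - lx b₂, lx b₂ - lx b₃] [2, 0]).all (e1ok 0) = true ∧
      (expSt [-lx b₁, lx b₁ - lx b₂, lx b₂ - lx b₃] [2, 0, 0]).all (e1ok 0) = true := by
  revert b₁ b₂ b₃; decide

/-- Negatives of the literals of `Fin 4` (for `simp`). [folklore] -/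
theorem fin4_neg : (-1 : Fin 4) = 3 ∧ (-2 : Fin 4) = 2 ∧ (-3 : Fin 4) = 1 := by decide

/-- **Family B.** For `s ≥ 1`, the finite double shuffle of `K3` (word `4^{a₁}c₁4^{a₂}c₂4^{a₃}c₃`)
with `((s, -1))` (word `4^{s-1} 2`): the three merged terms (extra `4^s` in block `j`, colours from
block `j` on swapped) sum to an element of `rel ⊔ (lower span)`. [cite: Zhao2010, §2 (FDS)] -/
theorem relB (a₁ a₂ a₃ s : ℕ) (hs : 1 ≤ s) (b₁ b₂ b₃ : Bool) :
    sym (X3 a₁ a₂ (a₃ + s) b₁ b₂ (!b₃)) + (sym (X3 a₁ (a₂ + s) a₃ b₁ (!b₂) (!b₃)) +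
      sym (X3 (a₁ + s) a₂ a₃ (!b₁) (!b₂) (!b₃))) ∈ T3 (a₁ + a₂ + a₃ + s) := by
  have hl : IsConvergentIdx [(s, 2)] := isConvergentIdx_cons hs (fun _ => by decide) (by simp)
  obtain ⟨hk0, hall, -, -⟩ := e1ok_families b₁ b₂ b₃
  have h := top_mem (isConvergentIdx_K3 a₁ a₂ a₃ b₁ b₂ b₃) hl (by simp) (map_snd_K3 a₁ a₂ a₃ b₁ b₂ b₃)
    rfl hk0 rfl hall (W := X3 0 0 (a₁ + a₂ + a₃ + s) true true true)
    (by rw [X3_length]; simp [wt, K3]; omega) (by rw [X3_count_four]; simp [wt, K3]; omega)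
  have hfilter : ((stuffleIdx (K3 a₁ a₂ a₃ b₁ b₂ b₃) [(s, 2)]).filter
      fun j => j.length = (K3 a₁ a₂ a₃ b₁ b₂ b₃).length) =
      [[(a₁ + 1, -lx b₁), (a₂ + 1, lx b₁ - lx b₂), (a₃ + 1 + s, lx b₂ - lx b₃ + 2)], [(a₁ + 1, -lx b₁),
        (a₂ + 1 + s, lx b₁ - lx b₂ + 2), (a₃ + 1, lx b₂ - lx b₃)], [(a₁ + 1 + s, -lx b₁ + 2),
        (a₂ + 1, lx b₁ - lx b₂), (a₃ + 1, lx b₂ - lx b₃)]] := rfl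
  rw [hfilter] at h
  have hsub : ∀ a : ℕ, a + 1 + s - 1 = a + s := fun a => by omega
  revert h
  cases b₁ <;> cases b₂ <;> cases b₃ <;> simp [word, wordAux, X3, T3, col, lx, hsub, fin4_neg]

/-- **Family B2.** For `s, t ≥ 1`, the finite double shuffle of `K3` with `((s, -1), (t, 1))` (word
`4^{s-1} 2 4^{t-1} 2`): the three doubly merged terms sum into `rel ⊔ (lower span)`. [cite: Zhao2010, §2] -/
theorem relB2 (a₁ a₂ a₃ s t : ℕ) (hs : 1 ≤ s) (ht : 1 ≤ t) (b₁ b₂ b₃ : Bool) :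
    sym (X3 a₁ (a₂ + s) (a₃ + t) b₁ (!b₂) (!b₃)) + (sym (X3 (a₁ + s) a₂ (a₃ + t) (!b₁) (!b₂) (!b₃)) +
      sym (X3 (a₁ + s) (a₂ + t) a₃ (!b₁) (!b₂) (!b₃))) ∈ T3 (a₁ + a₂ + a₃ + s + t) := by
  have hl : IsConvergentIdx [(s, 2), (t, 0)] :=
    isConvergentIdx_cons hs (fun _ => by decide) (by simpa using ht)
  obtain ⟨hk0, -, hall, -⟩ := e1ok_families b₁ b₂ b₃
  have h := top_mem (isConvergentIdx_K3 a₁ a₂ a₃ b₁ b₂ b₃) hl (by simp) (map_snd_K3 a₁ a₂ a₃ b₁ b₂ b₃)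
    rfl hk0 rfl hall (W := X3 0 0 (a₁ + a₂ + a₃ + s + t) true true true)
    (by rw [X3_length]; simp [wt, K3]; omega) (by rw [X3_count_four]; simp [wt, K3]; omega)
  have hfilter : ((stuffleIdx (K3 a₁ a₂ a₃ b₁ b₂ b₃) [(s, 2), (t, 0)]).filter
      fun j => j.length = (K3 a₁ a₂ a₃ b₁ b₂ b₃).length) =
      [[(a₁ + 1, -lx b₁), (a₂ + 1 + s, lx b₁ - lx b₂ + 2), (a₃ + 1 + t, lx b₂ - lx b₃ + 0)], [(a₁ + 1 + s,
        -lx b₁ + 2), (a₂ + 1, lx b₁ - lx b₂), (a₃ + 1 + t, lx b₂ - lx b₃ + 0)], [(a₁ + 1 + s, -lx b₁ + 2),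
        (a₂ + 1 + t, lx b₁ - lx b₂ + 0), (a₃ + 1, lx b₂ - lx b₃)]] := rfl
  rw [hfilter] at h
  have hsub : ∀ a : ℕ, a + 1 + s - 1 = a + s := fun a => by omega
  have htub : ∀ a : ℕ, a + 1 + t - 1 = a + t := fun a => by omega
  revert h
  cases b₁ <;> cases b₂ <;> cases b₃ <;> simp [word, wordAux, X3, T3, col, lx, hsub, htub, fin4_neg]

/-- **Family M33.** The finite double shuffle of `K3` with `((1, -1), (1, 1), (1, 1))` (word `2 2 2`)
has a single triply merged term `4^{a₁+1} c₁' 4^{a₂+1} c₂' 4^{a₃+1} c₃'`: every binary depth-three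
word with three nonempty blocks of `4` lies in `rel ⊔ (lower span)`. [cite: Zhao2010, §2 (FDS)] -/
theorem relM33 (a₁ a₂ a₃ : ℕ) (b₁ b₂ b₃ : Bool) :
    sym (X3 (a₁ + 1) (a₂ + 1) (a₃ + 1) (!b₁) (!b₂) (!b₃)) ∈ T3 (a₁ + a₂ + a₃ + 3) := by
  have hl : IsConvergentIdx [(1, 2), (1, 0), (1, 0)] := by decide
  obtain ⟨hk0, -, -, hall⟩ := e1ok_families b₁ b₂ b₃
  have h := top_mem (isConvergentIdx_K3 a₁ a₂ a₃ b₁ b₂ b₃) hl (by simp) (map_snd_K3 a₁ a₂ a₃ b₁ b₂ b₃)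
    rfl hk0 rfl hall (W := X3 0 0 (a₁ + a₂ + a₃ + 3) true true true)
    (by rw [X3_length]; simp [wt, K3]; omega) (by rw [X3_count_four]; simp [wt, K3]; omega)
  have hfilter : ((stuffleIdx (K3 a₁ a₂ a₃ b₁ b₂ b₃) [(1, 2), (1, 0), (1, 0)]).filter
      fun j => j.length = (K3 a₁ a₂ a₃ b₁ b₂ b₃).length) =
      [[(a₁ + 1 + 1, -lx b₁ + 2), (a₂ + 1 + 1, lx b₁ - lx b₂ + 0), (a₃ + 1 + 1, lx b₂ - lx b₃ + 0)]] := rfl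
  rw [hfilter] at h
  revert h
  cases b₁ <;> cases b₂ <;> cases b₃ <;> simp [word, wordAux, X3, T3, col, lx, fin4_neg]

/-! ## For file 2/2: the lift principle with a general word, and the layer `m = 1` -/

/-- **Lift principle, general lifting word.** As `liftMap_mem_sup_e0Lower`, for a convergent
`e₁`-free word `u` that may contain the letter `4`. [folklore] -/
theorem liftMap_mem_sup_e0Lower' {u V : List (Fin 5)} (hu : IsConvergent u) (hu0 : u.count 0 = 0)
    (hV : sym V ∈ rel ⊔ e0Lower V) : liftMap u (sym V) ∈ rel ⊔ e0Lower (u ++ V) := by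
  rw [Submodule.mem_sup] at hV ⊢
  obtain ⟨r, hr, l, hl, hrl⟩ := hV
  refine ⟨liftMap u r, liftMap_mem_rel hu hr, liftMap u l, ?_, by rw [← map_add, hrl]⟩
  refine Submodule.span_induction (p := fun x _ => liftMap u x ∈ e0Lower (u ++ V)) ?_ (by simp)
    (fun x y _ _ hx hy => by rw [map_add]; exact Submodule.add_mem _ hx hy)
    (fun a x _ hx => by rw [map_smul]; exact Submodule.smul_mem _ a hx) hl
  rintro _ ⟨V', ⟨h1, h2, h3, h4⟩, rfl⟩
  rw [liftMap_sym_eq_sum]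
  refine list_sum_mem fun x hx => ?_
  obtain ⟨w, hw, rfl⟩ := List.mem_map.1 hx
  have hp := MZV.perm_of_mem_shuffleWord _ _ hw
  refine sym_mem_e0Lower ?_ (isConvergent_of_mem_shuffleWord hu h2 hw) ?_ ?_
  · rw [hp.length_eq, List.length_append, List.length_append, h1]
  · rw [hp.count_eq, List.count_append, hu0, h3]
  · rw [hp.count_eq, List.count_append, List.count_append]; omega

/-- **The layer `m = 1`** (length four) from the landed two-letter normal form in weight `≤ 4`:
two-letter words are convergent, `e₁`-free and have no letter `4`. [folklore] -/
theorem depthThree_one {W : List (Fin 5)} (hW : IsConvergent W) (hn : W.length = 4)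
    (h4 : 0 < W.count 4) : sym W ∈ rel ⊔ e0Lower W := by
  refine (sup_le_sup_left (Submodule.span_le.2 ?_) rel) (twoLetterNormalForm_of_le_four 4 le_rfl W hn hW)
  rintro _ ⟨V, hV, rfl⟩
  obtain ⟨hVl, hV13⟩ := (mem_twoWords_iff 4 V).1 (Finset.mem_coe.1 hV)
  have hne : ∀ a ∈ V, a ≠ 0 ∧ a ≠ 4 := fun a ha => by
    rcases hV13 a ha with rfl | rfl <;> decide
  have hV0 : V.count 0 = 0 := List.count_eq_zero.2 fun h => (hne 0 h).1 rfl
  have hV4 : V.count 4 = 0 := List.count_eq_zero.2 fun h => (hne 4 h).2 rfl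
  refine sym_mem_e0Lower (by rw [hVl, hn]) ⟨fun h => ?_, fun h => ?_⟩ hV0 (by omega)
  · exact (hne 0 (List.mem_of_mem_head? h)).1 rfl
  · exact (hne 4 (List.mem_of_mem_getLast? h)).2 rfl

end Summit.KontsevichZagierPeriods.OctahedralSymmetry.OctaSpan.RegularE0

end
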